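import Summits.QuantumFields.YangMills.Theorems.ToronValleyVolumePeriodicRingCeiling
import Summits.QuantumFields.YangMills.Theorems.SwapTwistDeficitPeriodicRingFloorLogFloor
import Summits.QuantumFields.YangMills.Theorems.TwistEaterVolumeTauberLaplace
import Summits.QuantumFields.YangMills.Theorems.VirialFluxGapTauberWeights
import Summits.QuantumFields.YangMills.Theorems.SwapTwistDeficitSmallBallAllL
import HarnessLib

/-!
# The fixed-`L` periodic CEILING, III: the Laplace and ring-trace ceilings, and the TWO-SIDED law with its logarithm
# (free-hands support of ⟨stmt-QuantumFields-24497⟩ `ToronValleyVolume.ToronTubeVolumeLaw`)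

From the volume ceiling ✓`PeriodicRingCeiling.log_volume_ceiling` (`μ_L{F₀ ≤ u} ≤ C_L u^{9L⁴−3/2} log u⁻¹` on `(0,u₀]`):

* §1 ★ `laplace_ceiling_of_volume_ceiling` — abstract: on a probability space, `μ{F ≤ s} ≤ C s^ρ log s⁻¹` on `(0,u₀]` (`ρ ≥ 1`, `u₀ ≤ 1`) gives
  `∫e^{−βF}dμ ≤ (CΓ(ρ+1) + CΓ(ρ) + u₀^{−k}Γ(k+1))·β^{−ρ}·log β` for `β ≥ e` (`k ≥ ρ` an integer): layer cake ✓`Tauber.integral_exp_neg_mul_eq_integral_sublevel`,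
  `log s⁻¹ ≤ log β + (βs)⁻¹`, the tail `1 ≤ (s/u₀)^k`, Gamma weights ✓`TauberWeights.integral_weight`;
* §2 ★★ `log_laplace_ceiling` — `∫e^{−βF₀}dμ_L ≤ C_L β^{−(9L⁴−3/2)} log β`; ★★ `log_physTrace_ceiling` — `TT.physTrace L β (2L) ≤ C_L e^{12βL⁴}β^{−(9L⁴−3/2)}log β`
  (✓`sectorWeight_eq_exp_mul_integral_deficit`, the twisted sectors absorbed by ✓`SwapTwistDeficit.fluxSectorSuppression_allL`);
* §3 ★★★ `log_physTrace_two_sided` — with w3 g61's ✓`PeriodicRingFloor.log_physTrace_floor`: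
  `c_L·e^{12βL⁴}β^{−(9L⁴−3/2)}·log β ≤ Z_phys(L, β, 2L) ≤ C_L·e^{12βL⁴}β^{−(9L⁴−3/2)}·log β` for `β ≥ β₀(L)` — the fixed-`L` Laplace law of the
  periodic toron valley with the SHARP exponent `9L⁴ − 3/2` AND ITS MULTIPLICITY-2 LOGARITHM, two-sided.
HONEST LABEL: the fixed-`L` rung of ⟨24497⟩ (constants `exp(O(L⁴log L))`, no `poly(L)` uniformity, no `t^θ` remainder); ⟨24497⟩, ⟨24196⟩, ⟨24197⟩ stay OPEN;
no crux, rung or summit is proved; the Yang–Mills mass gap is NOT proved; no summit is proved by a line.  Seat ym-line-fcl-p3 g43 (cell ym-idea-1, free hands;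
`--supports stmt-QuantumFields-24497`).  THEOREMS ONLY (0 `def`, 0 `sorry`), standard axioms.  References: [cite: Luscher1983, §2]; [cite: Vanbaal2001];
[cite: Griffiths1964]; [folklore].
-/

set_option autoImplicit false

noncomputable section

open MeasureTheory Set
open scoped BigOperators ENNReal
open Literature.MathematicalPhysics.QuantumFieldTheory hiding SU2
open Literature.MathematicalPhysics.QuantumLattice
open Summit.QuantumFields.YangMills.Theorems.FemtoTransferGap
open Summit.QuantumFields.YangMills.Theorems.FemtoTransferGap.TT
open Summit.QuantumFields.YangMills.Theorems.VirialFluxGap.RingDeficit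
open Summit.QuantumFields.YangMills.Theorems.TwistEaterVolume.Tauber (integral_exp_neg_mul_eq_integral_sublevel integrableOn_mul_exp_neg_mul_mul_sublevel)
open Summit.QuantumFields.YangMills.Theorems.VirialFluxGap.TauberWeights (integral_weight integrableOn_weight)

namespace Summit.QuantumFields.YangMills.Theorems.ToronValleyVolume.PeriodicRingCeiling

/-! ## §1 The Laplace ceiling from a power-log volume ceiling (abstract) -/

/-- `log s⁻¹ ≤ log β + (βs)⁻¹` for `s, β > 0`. [folklore] -/
theorem log_inv_le_log_add_inv {s β : ℝ} (hs : 0 < s) (hβ : 0 < β) : Real.log s⁻¹ ≤ Real.log β + (β * s)⁻¹ := by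
  have h1 : Real.log (β * s)⁻¹ ≤ (β * s)⁻¹ - 1 := Real.log_le_sub_one_of_pos (by positivity)
  rw [Real.log_inv, Real.log_mul hβ.ne' hs.ne'] at h1
  rw [Real.log_inv]
  linarith

/-- `∫_{s>0} βe^{−βs}s^a ds = Γ(a+1)·β^{−a}` (`a > −1`, `β > 0`). [folklore] -/
theorem integral_weight_eq_rpow_neg {β a : ℝ} (hβ : 0 < β) (ha : -1 < a) :
    ∫ s in Ioi (0 : ℝ), β * Real.exp (-(β * s)) * s ^ a = Real.Gamma (a + 1) * β ^ (-a) := by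
  rw [integral_weight hβ ha, Real.rpow_add_one hβ.ne', Real.rpow_neg hβ.le]
  field_simp

/-- ★ **Laplace ceiling from a power-log volume ceiling.**  On a probability space, if `F ≥ 0` is measurable and
`μ{F ≤ s} ≤ C·s^ρ·log s⁻¹` for `0 < s ≤ u₀` (`0 ≤ C`, `1 ≤ ρ ≤ k`, `0 < u₀ ≤ 1`), then for `β ≥ e`:
`∫ e^{−βF} dμ ≤ (C·Γ(ρ+1) + C·Γ(ρ) + u₀^{-k}·Γ(k+1))·β^{−ρ}·log β`. [cite: Griffiths1964] -/
theorem laplace_ceiling_of_volume_ceiling {Ω : Type*} [MeasurableSpace Ω] (μ : Measure Ω) [IsProbabilityMeasure μ]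
    {F : Ω → ℝ} (hF : Measurable F) (hF0 : ∀ ω, 0 ≤ F ω) {C ρ u₀ : ℝ} {k : ℕ} (hC : 0 ≤ C) (hρ : 1 ≤ ρ) (hρk : ρ ≤ k)
    (hu₀ : 0 < u₀) (hvol : ∀ s : ℝ, 0 < s → s ≤ u₀ → μ.real {ω | F ω ≤ s} ≤ C * s ^ ρ * Real.log s⁻¹)
    {β : ℝ} (hβ : Real.exp 1 ≤ β) :
    ∫ ω, Real.exp (-(β * F ω)) ∂μ ≤
      (C * Real.Gamma (ρ + 1) + C * Real.Gamma ρ + (u₀ ^ k)⁻¹ * Real.Gamma (k + 1)) * β ^ (-ρ) * Real.log β := by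
  have hβ1 : 1 < β := lt_of_lt_of_le (by have := Real.add_one_le_exp (1 : ℝ); linarith) hβ
  have hβ0 : 0 < β := by linarith
  have hlogβ : 1 ≤ Real.log β := by rw [Real.le_log_iff_exp_le hβ0]; exact hβ
  have hlogβ0 : 0 ≤ Real.log β := by linarith
  have hρ0 : 0 < ρ := by linarith
  -- layer cake
  rw [integral_exp_neg_mul_eq_integral_sublevel (μ := μ) F hF hF0 hβ0]
  -- the majorant `g(s) = C log β·w_ρ(s) + (C/β)·w_{ρ−1}(s) + u₀^{-k}·w_k(s)`, `w_a(s) = βe^{−βs}s^a`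
  have hpt : ∀ s ∈ Ioi (0 : ℝ), β * Real.exp (-(β * s)) * μ.real {ω | F ω ≤ s} ≤
      C * Real.log β * (β * Real.exp (-(β * s)) * s ^ ρ) + C / β * (β * Real.exp (-(β * s)) * s ^ (ρ - 1)) +
        (u₀ ^ k)⁻¹ * (β * Real.exp (-(β * s)) * s ^ (k : ℝ)) := by
    intro s hs
    have hs0 : 0 < s := hs
    have hw0 : 0 ≤ β * Real.exp (-(β * s)) := by positivity
    have hsρ : 0 ≤ s ^ ρ := Real.rpow_nonneg hs0.le _
    have hsρ1 : 0 ≤ s ^ (ρ - 1) := Real.rpow_nonneg hs0.le _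
    have hsk : 0 ≤ s ^ (k : ℝ) := Real.rpow_nonneg hs0.le _
    have hterm3 : 0 ≤ (u₀ ^ k)⁻¹ * (β * Real.exp (-(β * s)) * s ^ (k : ℝ)) := by positivity
    have hA : 0 ≤ C * Real.log β * (β * Real.exp (-(β * s)) * s ^ ρ) := by positivity
    have hB : 0 ≤ C / β * (β * Real.exp (-(β * s)) * s ^ (ρ - 1)) := by positivity
    by_cases hsu : s ≤ u₀
    · -- small `s`: the volume law, `log s⁻¹ ≤ log β + (βs)⁻¹`
      have hv := hvol s hs0 hsu
      have hl := log_inv_le_log_add_inv hs0 hβ0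
      have h1 : μ.real {ω | F ω ≤ s} ≤ C * s ^ ρ * Real.log β + C * s ^ ρ * (β * s)⁻¹ := by
        have := mul_le_mul_of_nonneg_left hl (by positivity : 0 ≤ C * s ^ ρ)
        linarith
      have h2 : C * s ^ ρ * (β * s)⁻¹ = C / β * s ^ (ρ - 1) := by
        rw [Real.rpow_sub_one hs0.ne']
        field_simp
      rw [h2] at h1
      calc β * Real.exp (-(β * s)) * μ.real {ω | F ω ≤ s}
          ≤ β * Real.exp (-(β * s)) * (C * s ^ ρ * Real.log β + C / β * s ^ (ρ - 1)) := mul_le_mul_of_nonneg_left h1 hw0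
        _ = C * Real.log β * (β * Real.exp (-(β * s)) * s ^ ρ) + C / β * (β * Real.exp (-(β * s)) * s ^ (ρ - 1)) := by ring
        _ ≤ _ := by linarith
    · -- large `s`: `μ ≤ 1 ≤ (s/u₀)^k`
      have hsu' : u₀ < s := lt_of_not_ge hsu
      have h1 : μ.real {ω | F ω ≤ s} ≤ 1 := measureReal_le_one
      have h2 : (1 : ℝ) ≤ (u₀ ^ k)⁻¹ * s ^ (k : ℝ) := by
        rw [Real.rpow_natCast, ← div_eq_inv_mul, one_le_div (by positivity)]
        exact pow_le_pow_left₀ hu₀.le hsu'.le k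
      calc β * Real.exp (-(β * s)) * μ.real {ω | F ω ≤ s} ≤ β * Real.exp (-(β * s)) * 1 := mul_le_mul_of_nonneg_left h1 hw0
        _ ≤ β * Real.exp (-(β * s)) * ((u₀ ^ k)⁻¹ * s ^ (k : ℝ)) := mul_le_mul_of_nonneg_left h2 hw0
        _ = (u₀ ^ k)⁻¹ * (β * Real.exp (-(β * s)) * s ^ (k : ℝ)) := by ring
        _ ≤ _ := by linarith
  -- integrability
  have hi1 := integrableOn_weight hβ0 (by linarith : (-1 : ℝ) < ρ)
  have hi2 := integrableOn_weight hβ0 (by linarith : (-1 : ℝ) < ρ - 1)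
  have hi3 := integrableOn_weight hβ0 (by have h0 : (0 : ℝ) ≤ (k : ℝ) := Nat.cast_nonneg k; linarith : (-1 : ℝ) < (k : ℝ))
  have hi12 : IntegrableOn (fun s : ℝ => C * Real.log β * (β * Real.exp (-(β * s)) * s ^ ρ) + C / β * (β * Real.exp (-(β * s)) * s ^ (ρ - 1)))
      (Ioi 0) := (hi1.const_mul _).add (hi2.const_mul _)
  have hig : IntegrableOn (fun s : ℝ => C * Real.log β * (β * Real.exp (-(β * s)) * s ^ ρ) + C / β * (β * Real.exp (-(β * s)) * s ^ (ρ - 1)) +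
      (u₀ ^ k)⁻¹ * (β * Real.exp (-(β * s)) * s ^ (k : ℝ))) (Ioi 0) := hi12.add (hi3.const_mul _)
  have hiL := integrableOn_mul_exp_neg_mul_mul_sublevel (μ := μ) F hβ0
  refine (setIntegral_mono_on hiL hig measurableSet_Ioi hpt).trans ?_
  -- evaluate the majorant
  have e1 := integral_weight_eq_rpow_neg hβ0 (by linarith : (-1 : ℝ) < ρ)
  have e2 := integral_weight_eq_rpow_neg hβ0 (by linarith : (-1 : ℝ) < ρ - 1)
  have e3 := integral_weight_eq_rpow_neg hβ0 (by have h0 : (0 : ℝ) ≤ (k : ℝ) := Nat.cast_nonneg k; linarith : (-1 : ℝ) < (k : ℝ))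
  have hsplit1 : ∫ s in Ioi (0 : ℝ), (C * Real.log β * (β * Real.exp (-(β * s)) * s ^ ρ) + C / β * (β * Real.exp (-(β * s)) * s ^ (ρ - 1)) +
      (u₀ ^ k)⁻¹ * (β * Real.exp (-(β * s)) * s ^ (k : ℝ))) =
      (∫ s in Ioi (0 : ℝ), (C * Real.log β * (β * Real.exp (-(β * s)) * s ^ ρ) + C / β * (β * Real.exp (-(β * s)) * s ^ (ρ - 1)))) +
        ∫ s in Ioi (0 : ℝ), (u₀ ^ k)⁻¹ * (β * Real.exp (-(β * s)) * s ^ (k : ℝ)) := integral_add hi12 (hi3.const_mul _)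
  have hsplit2 : ∫ s in Ioi (0 : ℝ), (C * Real.log β * (β * Real.exp (-(β * s)) * s ^ ρ) + C / β * (β * Real.exp (-(β * s)) * s ^ (ρ - 1))) =
      (∫ s in Ioi (0 : ℝ), C * Real.log β * (β * Real.exp (-(β * s)) * s ^ ρ)) +
        ∫ s in Ioi (0 : ℝ), C / β * (β * Real.exp (-(β * s)) * s ^ (ρ - 1)) := integral_add (hi1.const_mul _) (hi2.const_mul _)
  have c1 : ∫ s in Ioi (0 : ℝ), C * Real.log β * (β * Real.exp (-(β * s)) * s ^ ρ) = C * Real.log β * (Real.Gamma (ρ + 1) * β ^ (-ρ)) := by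
    rw [← e1]; exact integral_const_mul _ _
  have c2 : ∫ s in Ioi (0 : ℝ), C / β * (β * Real.exp (-(β * s)) * s ^ (ρ - 1)) = C / β * (Real.Gamma (ρ - 1 + 1) * β ^ (-(ρ - 1))) := by
    rw [← e2]; exact integral_const_mul _ _
  have c3 : ∫ s in Ioi (0 : ℝ), (u₀ ^ k)⁻¹ * (β * Real.exp (-(β * s)) * s ^ (k : ℝ)) = (u₀ ^ k)⁻¹ * (Real.Gamma ((k : ℝ) + 1) * β ^ (-(k : ℝ))) := by
    rw [← e3]; exact integral_const_mul _ _
  rw [hsplit1, hsplit2, c1, c2, c3, sub_add_cancel]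
  -- compare term by term with `β^{-ρ} log β`
  have hGρ : 0 < Real.Gamma ρ := Real.Gamma_pos_of_pos hρ0
  have hGρ1 : 0 < Real.Gamma (ρ + 1) := Real.Gamma_pos_of_pos (by linarith)
  have hGk : 0 < Real.Gamma ((k : ℝ) + 1) := Real.Gamma_pos_of_pos (by positivity)
  have hbρ : 0 < β ^ (-ρ) := Real.rpow_pos_of_pos hβ0 _
  have t2 : C / β * (Real.Gamma ρ * β ^ (-(ρ - 1))) = C * Real.Gamma ρ * β ^ (-ρ) := by
    rw [neg_sub, Real.rpow_sub hβ0, Real.rpow_one, Real.rpow_neg hβ0.le]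
    field_simp
  have t3 : β ^ (-(k : ℝ)) ≤ β ^ (-ρ) := Real.rpow_le_rpow_of_exponent_le hβ1.le (by linarith)
  have h3 : (u₀ ^ k)⁻¹ * (Real.Gamma ((k : ℝ) + 1) * β ^ (-(k : ℝ))) ≤ (u₀ ^ k)⁻¹ * Real.Gamma (k + 1) * β ^ (-ρ) * Real.log β := by
    calc (u₀ ^ k)⁻¹ * (Real.Gamma ((k : ℝ) + 1) * β ^ (-(k : ℝ))) ≤ (u₀ ^ k)⁻¹ * (Real.Gamma ((k : ℝ) + 1) * β ^ (-ρ)) :=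
          mul_le_mul_of_nonneg_left (mul_le_mul_of_nonneg_left t3 hGk.le) (by positivity)
      _ = (u₀ ^ k)⁻¹ * Real.Gamma (k + 1) * β ^ (-ρ) * 1 := by ring
      _ ≤ (u₀ ^ k)⁻¹ * Real.Gamma (k + 1) * β ^ (-ρ) * Real.log β := mul_le_mul_of_nonneg_left hlogβ (by positivity)
  have h2 : C * Real.Gamma ρ * β ^ (-ρ) ≤ C * Real.Gamma ρ * β ^ (-ρ) * Real.log β := by
    calc C * Real.Gamma ρ * β ^ (-ρ) = C * Real.Gamma ρ * β ^ (-ρ) * 1 := (mul_one _).symm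
      _ ≤ C * Real.Gamma ρ * β ^ (-ρ) * Real.log β := mul_le_mul_of_nonneg_left hlogβ (by positivity)
  rw [t2]
  nlinarith [h2, h3, hbρ, hGρ1]

/-! ## §2 The Laplace and ring-trace ceilings at fixed `L` -/

variable {L : ℕ} [NeZero L]

/-- ★★ **The Laplace ceiling with its logarithm**: `∫e^{−βF₀}dμ_L ≤ C_L·β^{−(9L⁴−3/2)}·log β` for `β ≥ β₀`. [cite: Luscher1983, §2] [cite: Vanbaal2001] -/
theorem log_laplace_ceiling (L : ℕ) [NeZero L] :
    ∃ C : ℝ, 0 < C ∧ ∃ β₀ : ℝ, ∀ β : ℝ, β₀ ≤ β →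
      ∫ P, Real.exp (-(β * ringDeficit L (fun _ => false) P)) ∂(ringMeasure L) ≤ C * β ^ (-(9 * (L : ℝ) ^ 4 - 3 / 2)) * Real.log β := by
  haveI := isProbabilityMeasure_ringMeasure (L := L)
  obtain ⟨C, hC, u₀, hu₀, hvol⟩ := log_volume_ceiling L
  have hL1 : (1 : ℝ) ≤ L := by exact_mod_cast NeZero.one_le
  have hL4 : (1 : ℝ) ≤ (L : ℝ) ^ 4 := one_le_pow₀ hL1
  set ρ : ℝ := 9 * (L : ℝ) ^ 4 - 3 / 2 with hρ
  have hρ1 : 1 ≤ ρ := by rw [hρ]; linarith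
  set k : ℕ := 9 * L ^ 4 with hk
  have hρk : ρ ≤ (k : ℝ) := by rw [hρ, hk]; push_cast; linarith
  refine ⟨C * Real.Gamma (ρ + 1) + C * Real.Gamma ρ + (u₀ ^ k)⁻¹ * Real.Gamma (k + 1), ?_, Real.exp 1, fun β hβ => ?_⟩
  · have h1 : 0 < Real.Gamma (ρ + 1) := Real.Gamma_pos_of_pos (by linarith)
    have h2 : 0 < Real.Gamma ρ := Real.Gamma_pos_of_pos (by linarith)
    have h3 : 0 < Real.Gamma ((k : ℝ) + 1) := Real.Gamma_pos_of_pos (by positivity)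
    positivity
  exact laplace_ceiling_of_volume_ceiling (ringMeasure L) (measurable_ringDeficit _) (ringDeficit_nonneg _) hC.le hρ1 hρk hu₀
    (fun s hs hsu => hvol s hs hsu) hβ

/-- ★★ **The ring-trace ceiling with its logarithm**: `TT.physTrace L β (2L) ≤ C_L·e^{12βL⁴}·β^{−(9L⁴−3/2)}·log β` for `β ≥ β₀`
(the zero-flux sector by `log_laplace_ceiling`; the seven twisted sectors are `≤ β^{−a}·physTrace` by ✓`fluxSectorSuppression_allL`, hence absorbed).
[cite: Luscher1983, §2] [cite: Vanbaal2001] -/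
theorem log_physTrace_ceiling (L : ℕ) [NeZero L] :
    ∃ C : ℝ, 0 < C ∧ ∃ β₀ : ℝ, ∀ β : ℝ, β₀ ≤ β →
      TT.physTrace L β (2 * L) ≤ C * Real.exp (12 * β * (L : ℝ) ^ 4) * β ^ (-(9 * (L : ℝ) ^ 4 - 3 / 2)) * Real.log β := by
  obtain ⟨C, hC, β₁, hlap⟩ := log_laplace_ceiling L
  obtain ⟨a, ha, β₂, hsupp⟩ := SwapTwistDeficit.fluxSectorSuppression_allL
  have hL0 : (0 : ℝ) < L := by exact_mod_cast NeZero.pos L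
  -- threshold: `β ≥ β₁`, `β ≥ β₂`, `β ≥ 1`, `L ≤ β^a` (i.e. `β ≥ L^{1/a}`)
  refine ⟨C, hC, max (max β₁ β₂) (max 1 ((L : ℝ) ^ (1 / a))), fun β hβ => ?_⟩
  have hβ₁ : β₁ ≤ β := le_trans ((le_max_left _ _).trans (le_max_left _ _)) hβ
  have hβ₂ : β₂ ≤ β := le_trans ((le_max_right _ _).trans (le_max_left _ _)) hβ
  have hβ1 : 1 ≤ β := le_trans ((le_max_left _ _).trans (le_max_right _ _)) hβ
  have hβL : (L : ℝ) ^ (1 / a) ≤ β := le_trans ((le_max_right _ _).trans (le_max_right _ _)) hβ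
  have hβ0 : 0 < β := by linarith
  have hLa : (L : ℝ) ≤ β ^ a := by
    have h := Real.rpow_le_rpow (by positivity) hβL ha.le
    rwa [← Real.rpow_mul hL0.le, one_div_mul_cancel ha.ne', Real.rpow_one] at h
  -- the sector decomposition
  set W : (Fin 3 → Bool) → ℝ := fun z => sectorWeight (L := L) β (2 * L - 1) z (fun _ _ => (1 : ℝ)) with hW
  set Z : ℝ := TT.physTrace L β (2 * L) with hZ
  have hZsum : Z = (1 / 8 : ℝ) * ∑ z, W z := physTraceSucc_eq_sum_sectorWeight (L := L) β (2 * L - 1)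
  have hZpos : 0 < Z := by
    rw [hZsum]; exact mul_pos (by norm_num) (Finset.sum_pos (fun z _ => SectorSmooth.sectorWeight_one_pos β (2 * L - 1) z) Finset.univ_nonempty)
  set z0 : Fin 3 → Bool := fun _ => false with hz0
  have hWz : ∀ z, z ≠ z0 → W z ≤ β ^ (-a) * Z := fun z hz => hsupp β hβ₂ L hLa z (by simpa [hz0] using hz)
  have hcard : (Finset.univ.erase z0).card = 7 := by
    rw [Finset.card_erase_of_mem (Finset.mem_univ _)]; simp
  have hsum_erase : ∑ z ∈ Finset.univ.erase z0, W z ≤ 7 * (β ^ (-a) * Z) := by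
    have := Finset.sum_le_card_nsmul (Finset.univ.erase z0) W (β ^ (-a) * Z) (fun z hz => hWz z (Finset.ne_of_mem_erase hz))
    rw [hcard] at this
    simpa [nsmul_eq_mul] using this
  have hsplit : ∑ z, W z = W z0 + ∑ z ∈ Finset.univ.erase z0, W z := (Finset.add_sum_erase _ _ (Finset.mem_univ z0)).symm
  have hβa : β ^ (-a) ≤ 1 := Real.rpow_le_one_of_one_le_of_nonpos hβ1 (by linarith)
  -- `8Z ≤ W₀ + 7β^{-a}Z ≤ W₀ + 7Z`, so `Z ≤ W₀`
  have hZW : Z ≤ W z0 := by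
    have h8 : 8 * Z = ∑ z, W z := by rw [hZsum]; ring
    nlinarith [hsum_erase, hsplit, hZpos, hβa]
  -- `W₀ = e^{12βL⁴} ∫ e^{−βF₀}`
  have hW0 : W z0 = Real.exp (12 * β * (L : ℝ) ^ 4) * ∫ p, Real.exp (-(β * ringDeficit L (fun _ => false) p)) ∂(ringMeasure L) :=
    sectorWeight_eq_exp_mul_integral_deficit β z0
  calc Z ≤ W z0 := hZW
    _ ≤ Real.exp (12 * β * (L : ℝ) ^ 4) * (C * β ^ (-(9 * (L : ℝ) ^ 4 - 3 / 2)) * Real.log β) := by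
        rw [hW0]; exact mul_le_mul_of_nonneg_left (hlap β hβ₁) (Real.exp_pos _).le
    _ = C * Real.exp (12 * β * (L : ℝ) ^ 4) * β ^ (-(9 * (L : ℝ) ^ 4 - 3 / 2)) * Real.log β := by ring

/-! ## §3 The two-sided fixed-`L` law with its logarithm -/

/-- ★★★ **THE FIXED-`L` LAPLACE LAW OF THE PERIODIC TORON VALLEY, TWO-SIDED, WITH ITS LOGARITHM.**  For every `L` there are `0 < c ≤ C` and `β₀`
with `c·e^{12βL⁴}·β^{−(9L⁴−3/2)}·log β ≤ TT.physTrace L β (2L) ≤ C·e^{12βL⁴}·β^{−(9L⁴−3/2)}·log β` for all `β ≥ β₀`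
(floor: ✓`PeriodicRingFloor.log_physTrace_floor`, seat w3 g61 + ✓`ToronLog`, seat w2 g54; ceiling: this file).  The real log-canonical threshold
`9L⁴ − 3/2` with multiplicity EXACTLY `2` at every fixed `L` — the shape of `ToronTubeVolumeLaw` (⟨24497⟩) sector by sector, without its
`poly(L)`-uniformity or `t^θ`-remainder. [cite: Luscher1983, §2] [cite: Vanbaal2001] -/
theorem log_physTrace_two_sided (L : ℕ) [NeZero L] :
    ∃ c : ℝ, 0 < c ∧ ∃ C : ℝ, 0 < C ∧ ∃ β₀ : ℝ, ∀ β : ℝ, β₀ ≤ β →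
      c * Real.exp (12 * β * (L : ℝ) ^ 4) * β ^ (-(9 * (L : ℝ) ^ 4 - 3 / 2)) * Real.log β ≤ TT.physTrace L β (2 * L) ∧
        TT.physTrace L β (2 * L) ≤ C * Real.exp (12 * β * (L : ℝ) ^ 4) * β ^ (-(9 * (L : ℝ) ^ 4 - 3 / 2)) * Real.log β := by
  obtain ⟨c, hc, β₁, hlow⟩ := SwapTwistDeficit.PeriodicRingFloor.log_physTrace_floor L
  obtain ⟨C, hC, β₂, hup⟩ := log_physTrace_ceiling L
  exact ⟨c, hc, C, hC, max β₁ β₂, fun β hβ => ⟨hlow β ((le_max_left _ _).trans hβ), hup β ((le_max_right _ _).trans hβ)⟩⟩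

/-- ★★★ **Two-sided volume law with its logarithm** (✓`PeriodicRingFloor.log_volume_floor` of seat w3 g61 and `log_volume_ceiling`):
`c·u^{9L⁴−3/2}·log u⁻¹ ≤ μ_L{F₀ ≤ u} ≤ C·u^{9L⁴−3/2}·log u⁻¹` for `0 < u ≤ u₀`. [cite: Luscher1983, §2] [cite: Vanbaal2001] -/
theorem log_volume_two_sided (L : ℕ) [NeZero L] :
    ∃ c : ℝ, 0 < c ∧ ∃ C : ℝ, 0 < C ∧ ∃ u₀ : ℝ, 0 < u₀ ∧ ∀ u : ℝ, 0 < u → u ≤ u₀ →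
      c * u ^ (9 * (L : ℝ) ^ 4 - 3 / 2) * Real.log u⁻¹ ≤ (ringMeasure L).real {P | ringDeficit L (fun _ => false) P ≤ u} ∧
        (ringMeasure L).real {P | ringDeficit L (fun _ => false) P ≤ u} ≤ C * u ^ (9 * (L : ℝ) ^ 4 - 3 / 2) * Real.log u⁻¹ := by
  obtain ⟨c, hc, u₁, hu₁, hlow⟩ := SwapTwistDeficit.PeriodicRingFloor.log_volume_floor L
  obtain ⟨C, hC, u₂, hu₂, hup⟩ := log_volume_ceiling L
  exact ⟨c, hc, C, hC, min u₁ u₂, lt_min hu₁ hu₂, fun u hu huu =>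
    ⟨hlow u hu (huu.trans (min_le_left _ _)), hup u hu (huu.trans (min_le_right _ _))⟩⟩

/-- ★★★ **Two-sided Laplace law with its logarithm** (✓`PeriodicRingFloor.log_laplace_floor` and `log_laplace_ceiling`):
`c·β^{−(9L⁴−3/2)}·log β ≤ ∫e^{−βF₀}dμ_L ≤ C·β^{−(9L⁴−3/2)}·log β` for `β ≥ β₀`. [cite: Luscher1983, §2] [cite: Vanbaal2001] -/
theorem log_laplace_two_sided (L : ℕ) [NeZero L] :
    ∃ c : ℝ, 0 < c ∧ ∃ C : ℝ, 0 < C ∧ ∃ β₀ : ℝ, ∀ β : ℝ, β₀ ≤ β →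
      c * β ^ (-(9 * (L : ℝ) ^ 4 - 3 / 2)) * Real.log β ≤ ∫ P, Real.exp (-(β * ringDeficit L (fun _ => false) P)) ∂(ringMeasure L) ∧
        ∫ P, Real.exp (-(β * ringDeficit L (fun _ => false) P)) ∂(ringMeasure L) ≤ C * β ^ (-(9 * (L : ℝ) ^ 4 - 3 / 2)) * Real.log β := by
  obtain ⟨c, hc, β₁, hlow⟩ := SwapTwistDeficit.PeriodicRingFloor.log_laplace_floor L
  obtain ⟨C, hC, β₂, hup⟩ := log_laplace_ceiling L
  exact ⟨c, hc, C, hC, max β₁ β₂, fun β hβ => ⟨hlow β ((le_max_left _ _).trans hβ), hup β ((le_max_right _ _).trans hβ)⟩⟩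

end Summit.QuantumFields.YangMills.Theorems.ToronValleyVolume.PeriodicRingCeiling

end
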